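import Mathlib
import Summits.NavierStokesRegularity.NavierStokesRegularity.Theorems.EulerZoomLiouvillePowerGaugeEulerLiouvilleShellLawTools
import Summits.NavierStokesRegularity.NavierStokesRegularity.Theorems.EulerZoomLiouvillePowerGaugeEulerLiouvilleTransportMoments

/-!
# R49 plate 2.9 (t52-FF), TOOLS: exterior integrability and sphere selection under the self-similar (A)/(D) budgets
# (nsreg-p2 ROUND-49 «EVERY BALL BREATHES», `NsregP2.R49.FarFieldSphereMean`; seat ns-ezl-w2 g6, `--supports stmt-NavierStokesRegularity-19832 --as helper`)

Class-free real analysis for the far-field sphere-mean law (HOOP-NOTE §1 CLASS READING, ns-idea-11; R49 2.9):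
* `integral_ball_normSq_le_of_budget` — an (A)-type budget `L^{2ρ−1}∫_{B_L}‖U‖² ≤ C` (`L ≥ 1`) gives `∫_{B_L}‖U‖² ≤ C(1 + L^{1−2ρ})` for every `L > 0`;
* `integrableOn_normSq_div_cube_compl_ball` — then `‖U‖²‖y‖⁻³` is integrable on `{‖y‖ ≥ r}` (`r > 0`; dyadic shells, two geometric series);
* `integrableOn_twoSphereIntegrand_compl_ball` — hence so is the two-sphere integrand `(3U_n² − ‖U‖²)‖y‖⁻³` (`|3U_n² − ‖U‖²| ≤ 2‖U‖²`);
* `exists_radius_sphere_le_shellAverage` — on every dyadic block `[R, 2R]` some sphere carries at most the shell average of `‖U‖² + |Q|`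
  (polar coordinates on the shell + `exists_le_setAverage`);
* `setIntegral_abs_le_young` — Young with exponents `3/2, 3`: `∫_S |Q| ≤ (2/3)ε∫|Q|^{3/2}‖y‖^{2ρ−2} + (1/3)ε⁻²∫_S ‖y‖^{4−4ρ}` (the (D)-budget side).

HONEST FRAMING: calculus tools (ROUND-49 instrument); nothing about the crux E (19832 OPEN) or NS regularity. [folklore]
-/

noncomputable section

set_option linter.dupNamespace false

open MeasureTheory Set Filter Topology Metric Function TopologicalSpace
open scoped ENNReal NNReal RealInnerProductSpace Topology

namespace Summit.NavierStokesRegularity.NavierStokesRegularity.Theorems.PowerGaugeEulerLiouville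

open Literature.Analysis Literature.Analysis.FunctionSpaces Literature.Analysis.FluidPDE

namespace ClassicalProfile

section Budget

variable {U : EuclideanSpace ℝ (Fin 3) → EuclideanSpace ℝ (Fin 3)}

/-- **The (A)-budget at every radius**: if `L^{2ρ−1}∫_{B_L}‖U‖² ≤ C` for `L ≥ 1`, then `∫_{B_L}‖U‖² ≤ C(1 + L^{1−2ρ})` for every `L > 0`. [folklore] -/
theorem integral_ball_normSq_le_of_budget (hU : Continuous U) {C ρ : ℝ}
    (hA : ∀ L : ℝ, 1 ≤ L → L ^ (2 * ρ - 1) * ∫ y in ball (0 : EuclideanSpace ℝ (Fin 3)) L, ‖U y‖ ^ 2 ≤ C) {L : ℝ} (hL0 : 0 < L) :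
    ∫ y in ball (0 : EuclideanSpace ℝ (Fin 3)) L, ‖U y‖ ^ 2 ≤ C * (1 + L ^ (1 - 2 * ρ)) := by
  have hnn : ∀ L : ℝ, 0 ≤ ∫ y in ball (0 : EuclideanSpace ℝ (Fin 3)) L, ‖U y‖ ^ 2 := fun L =>
    setIntegral_nonneg measurableSet_ball fun y _ => sq_nonneg _
  have h1 := hA 1 le_rfl
  rw [Real.one_rpow, one_mul] at h1
  have hC : 0 ≤ C := (hnn 1).trans h1
  have hLp : 0 ≤ L ^ (1 - 2 * ρ) := Real.rpow_nonneg hL0.le _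
  by_cases hL : 1 ≤ L
  · have h := hA L hL
    have hpow : 0 < L ^ (2 * ρ - 1) := Real.rpow_pos_of_pos hL0 _
    have h2 : ∫ y in ball (0 : EuclideanSpace ℝ (Fin 3)) L, ‖U y‖ ^ 2 ≤ C * L ^ (1 - 2 * ρ) := by
      have h3 := (le_div_iff₀' hpow).2 h
      rwa [div_eq_mul_inv, ← Real.rpow_neg hL0.le, show -(2 * ρ - 1) = 1 - 2 * ρ by ring] at h3
    nlinarith
  · push Not at hL
    have hmono : ∫ y in ball (0 : EuclideanSpace ℝ (Fin 3)) L, ‖U y‖ ^ 2 ≤ ∫ y in ball (0 : EuclideanSpace ℝ (Fin 3)) 1, ‖U y‖ ^ 2 :=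
      setIntegral_mono_set (((hU.norm.pow 2).continuousOn.integrableOn_compact (isCompact_closedBall 0 1)).mono_set
        ball_subset_closedBall) (ae_of_all _ fun y => sq_nonneg _) (ae_of_all _ (ball_subset_ball hL.le))
    nlinarith

/-- `‖U‖²‖y‖⁻³` is integrable on each closed dyadic shell away from the origin (continuity on a compact set). [folklore] -/
theorem integrableOn_normSq_div_cube_shell (hU : Continuous U) {a : ℝ} (ha : 0 < a) (b : ℝ) :
    IntegrableOn (fun y : EuclideanSpace ℝ (Fin 3) => ‖U y‖ ^ 2 / ‖y‖ ^ 3)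
      (ball (0 : EuclideanSpace ℝ (Fin 3)) b \ ball 0 a) := by
  have hK : IsCompact (closedBall (0 : EuclideanSpace ℝ (Fin 3)) b \ ball 0 a) := (isCompact_closedBall _ _).diff isOpen_ball
  refine (ContinuousOn.integrableOn_compact hK ?_).mono_set fun y hy => ⟨ball_subset_closedBall hy.1, hy.2⟩
  intro y hy
  have hn : ‖y‖ ≠ 0 := by
    intro h0
    exact hy.2 (mem_ball_zero_iff.2 (by rw [h0]; exact ha))
  exact (((hU.norm.pow 2).continuousAt).div ((continuous_norm.pow 3).continuousAt) (pow_ne_zero 3 hn)).continuousWithinAt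

/-- **Exterior integrability under the (A)-budget**: if `∫_{B_L}‖U‖² ≤ C(1 + L^{1−2ρ})` for all `L > 0` with `ρ > −1`, then `‖U‖²‖y‖⁻³` is
integrable on `{‖y‖ ≥ r}` for every `r > 0` (dyadic shells `[2^k r, 2^{k+1} r)`: each contributes `≤ (2^k r)⁻³·C(1 + (2^{k+1}r)^{1−2ρ})`, the sum
of two geometric series with ratios `1/8` and `2^{−2−2ρ}`). [folklore] -/
theorem integrableOn_normSq_div_cube_compl_ball (hU : Continuous U) {C ρ r : ℝ} (hρ : -1 < ρ) (hr : 0 < r)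
    (hE : ∀ L : ℝ, 0 < L → ∫ y in ball (0 : EuclideanSpace ℝ (Fin 3)) L, ‖U y‖ ^ 2 ≤ C * (1 + L ^ (1 - 2 * ρ))) :
    IntegrableOn (fun y : EuclideanSpace ℝ (Fin 3) => ‖U y‖ ^ 2 / ‖y‖ ^ 3) (ball (0 : EuclideanSpace ℝ (Fin 3)) r)ᶜ := by
  -- the dyadic shells
  set s : ℕ → Set (EuclideanSpace ℝ (Fin 3)) := fun k => ball 0 (2 ^ (k + 1) * r) \ ball 0 (2 ^ k * r) with hs
  have hcover : (ball (0 : EuclideanSpace ℝ (Fin 3)) r)ᶜ = ⋃ k, s k := by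
    ext y
    simp only [mem_compl_iff, mem_ball_zero_iff, not_lt, mem_iUnion, hs, Set.mem_sdiff]
    constructor
    · intro hy
      -- `k` = the first exponent with `‖y‖ < 2^{k+1} r`
      have hex : ∃ k : ℕ, ‖y‖ < 2 ^ (k + 1) * r := by
        obtain ⟨k, hk⟩ := pow_unbounded_of_one_lt (‖y‖ / r) (by norm_num : (1 : ℝ) < 2)
        refine ⟨k, ?_⟩
        rw [div_lt_iff₀ hr] at hk
        calc ‖y‖ < 2 ^ k * r := hk
          _ ≤ 2 ^ (k + 1) * r := by
            apply mul_le_mul_of_nonneg_right _ hr.le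
            exact pow_le_pow_right₀ (by norm_num) (Nat.le_succ k)
      classical
      refine ⟨Nat.find hex, Nat.find_spec hex, ?_⟩
      rcases Nat.eq_zero_or_pos (Nat.find hex) with h0 | hpos
      · rw [h0, pow_zero, one_mul]; exact hy
      · have hk := Nat.find_min hex (Nat.sub_one_lt_of_lt hpos)
        rw [not_lt, Nat.sub_add_cancel hpos] at hk
        exact hk
    · rintro ⟨k, hk1, hk2⟩
      calc r = 2 ^ 0 * r := by simp
        _ ≤ 2 ^ k * r := mul_le_mul_of_nonneg_right (pow_le_pow_right₀ (by norm_num) (Nat.zero_le k)) hr.le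
        _ ≤ ‖y‖ := hk2
  rw [hcover]
  refine integrableOn_iUnion_of_summable_integral_norm (fun k => ?_) ?_
  · exact integrableOn_normSq_div_cube_shell hU (by positivity) _
  -- the geometric bound on each shell
  have hC : 0 ≤ C := by
    have h := hE 1 one_pos
    rw [Real.one_rpow] at h
    have h0 : 0 ≤ ∫ y in ball (0 : EuclideanSpace ℝ (Fin 3)) 1, ‖U y‖ ^ 2 := setIntegral_nonneg measurableSet_ball fun y _ => sq_nonneg _
    linarith
  have hbound : ∀ k : ℕ, ∫ y in s k, ‖(fun y : EuclideanSpace ℝ (Fin 3) => ‖U y‖ ^ 2 / ‖y‖ ^ 3) y‖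
      ≤ C * r⁻¹ ^ 3 * (1 / 8 : ℝ) ^ k + C * r⁻¹ ^ 3 * (2 * r) ^ (1 - 2 * ρ) * ((2 : ℝ) ^ (-2 - 2 * ρ)) ^ k := by
    intro k
    have h2k : 0 < (2 : ℝ) ^ k * r := by positivity
    have hI := integrableOn_normSq_div_cube_shell hU h2k (2 ^ (k + 1) * r)
    -- pointwise on the shell: `‖U‖²/‖y‖³ ≤ (2^k r)⁻³ ‖U‖²`
    have hpt : ∀ y ∈ s k, ‖(fun y : EuclideanSpace ℝ (Fin 3) => ‖U y‖ ^ 2 / ‖y‖ ^ 3) y‖ ≤ ((2 : ℝ) ^ k * r)⁻¹ ^ 3 * ‖U y‖ ^ 2 := by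
      intro y hy
      have hy2 : (2 : ℝ) ^ k * r ≤ ‖y‖ := by
        have := hy.2; rw [mem_ball_zero_iff, not_lt] at this; exact this
      have hypos : 0 < ‖y‖ := h2k.trans_le hy2
      rw [Real.norm_eq_abs, abs_of_nonneg (div_nonneg (sq_nonneg _) (pow_nonneg (norm_nonneg _) 3)), div_eq_mul_inv, mul_comm,
        ← inv_pow]
      exact mul_le_mul_of_nonneg_right (pow_le_pow_left₀ (inv_nonneg.2 hypos.le) ((inv_le_inv₀ hypos h2k).2 hy2) 3) (sq_nonneg _)
    have hmono := setIntegral_mono_on hI.norm (((hU.norm.pow 2).continuousOn.integrableOn_compact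
        (isCompact_closedBall (0 : EuclideanSpace ℝ (Fin 3)) (2 ^ (k + 1) * r))).mono_set
        (fun y hy => ball_subset_closedBall hy.1) |>.const_mul _) (measurableSet_ball.diff measurableSet_ball) hpt
    rw [integral_const_mul] at hmono
    have hsub : ∫ y in s k, ‖U y‖ ^ 2 ≤ ∫ y in ball (0 : EuclideanSpace ℝ (Fin 3)) (2 ^ (k + 1) * r), ‖U y‖ ^ 2 :=
      setIntegral_mono_set (((hU.norm.pow 2).continuousOn.integrableOn_compact (isCompact_closedBall 0 _)).mono_set
        ball_subset_closedBall) (ae_of_all _ fun y => sq_nonneg _) (ae_of_all _ fun y hy => hy.1)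
    have hEk := hE (2 ^ (k + 1) * r) (by positivity)
    have hinv : 0 ≤ ((2 : ℝ) ^ k * r)⁻¹ ^ 3 := by positivity
    have e1 : ((2 : ℝ) ^ k * r)⁻¹ ^ 3 = r⁻¹ ^ 3 * (1 / 8 : ℝ) ^ k := by
      rw [mul_inv, mul_pow, ← inv_pow, ← pow_mul, mul_comm k 3, pow_mul]
      norm_num
      ring
    have e2 : ((2 : ℝ) ^ (k + 1) * r) ^ (1 - 2 * ρ) = (2 * r) ^ (1 - 2 * ρ) * ((2 : ℝ) ^ (1 - 2 * ρ)) ^ k := by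
      rw [pow_succ, mul_assoc, mul_comm ((2 : ℝ) ^ k), Real.mul_rpow (by positivity) (by positivity), ← Real.rpow_natCast,
        ← Real.rpow_mul (by norm_num), mul_comm (k : ℝ), Real.rpow_mul (by norm_num), Real.rpow_natCast]
    have e3 : (1 / 8 : ℝ) ^ k * ((2 : ℝ) ^ (1 - 2 * ρ)) ^ k = ((2 : ℝ) ^ (-2 - 2 * ρ)) ^ k := by
      rw [← mul_pow]
      congr 1
      rw [show (1 / 8 : ℝ) = (2 : ℝ) ^ (-3 : ℝ) by norm_num [Real.rpow_neg, Real.rpow_natCast], ← Real.rpow_add (by norm_num)]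
      ring_nf
    calc ∫ y in s k, ‖(fun y : EuclideanSpace ℝ (Fin 3) => ‖U y‖ ^ 2 / ‖y‖ ^ 3) y‖
        ≤ ((2 : ℝ) ^ k * r)⁻¹ ^ 3 * ∫ y in s k, ‖U y‖ ^ 2 := hmono
      _ ≤ ((2 : ℝ) ^ k * r)⁻¹ ^ 3 * (C * (1 + ((2 : ℝ) ^ (k + 1) * r) ^ (1 - 2 * ρ))) :=
          mul_le_mul_of_nonneg_left (hsub.trans hEk) hinv
      _ = C * r⁻¹ ^ 3 * (1 / 8 : ℝ) ^ k + C * r⁻¹ ^ 3 * (2 * r) ^ (1 - 2 * ρ) * ((2 : ℝ) ^ (-2 - 2 * ρ)) ^ k := by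
          rw [e1, e2, ← e3]; ring
  refine Summable.of_nonneg_of_le (fun k => integral_nonneg fun y => norm_nonneg _) hbound ?_
  have hq1 : (2 : ℝ) ^ (-2 - 2 * ρ) < 1 := Real.rpow_lt_one_of_one_lt_of_neg (by norm_num) (by linarith)
  have hq0 : 0 ≤ (2 : ℝ) ^ (-2 - 2 * ρ) := Real.rpow_nonneg (by norm_num) _
  exact ((summable_geometric_of_lt_one (by norm_num) (by norm_num)).mul_left _).add
    ((summable_geometric_of_lt_one hq0 hq1).mul_left _)

/-- `⟪w, z⟫²/‖z‖² ≤ ‖w‖²`. [folklore] -/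
private theorem inner_sq_div_norm_sq_le_ff (w z : EuclideanSpace ℝ (Fin 3)) : ⟪w, z⟫ ^ 2 / ‖z‖ ^ 2 ≤ ‖w‖ ^ 2 := by
  by_cases hz : z = 0
  · simp [hz]
  · rw [div_le_iff₀ (by positivity)]
    have h := abs_real_inner_le_norm w z
    have h0 : 0 ≤ |⟪w, z⟫| := abs_nonneg _
    nlinarith [sq_abs ⟪w, z⟫, norm_nonneg w, norm_nonneg z, mul_nonneg (norm_nonneg w) (norm_nonneg z)]

/-- **The two-sphere integrand is integrable on the exterior of every ball** under the (A)-budget: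
`(3⟪U,y⟫²/‖y‖² − ‖U‖²)/‖y‖³ ∈ L¹({‖y‖ ≥ r})` (`|3U_n² − ‖U‖²| ≤ 2‖U‖²`). [folklore] -/
theorem integrableOn_twoSphereIntegrand_compl_ball (hU : Continuous U) {C ρ r : ℝ} (hρ : -1 < ρ) (hr : 0 < r)
    (hE : ∀ L : ℝ, 0 < L → ∫ y in ball (0 : EuclideanSpace ℝ (Fin 3)) L, ‖U y‖ ^ 2 ≤ C * (1 + L ^ (1 - 2 * ρ))) :
    IntegrableOn (fun y : EuclideanSpace ℝ (Fin 3) => (3 * ⟪U y, y⟫ ^ 2 / ‖y‖ ^ 2 - ‖U y‖ ^ 2) / ‖y‖ ^ 3)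
      (ball (0 : EuclideanSpace ℝ (Fin 3)) r)ᶜ := by
  have hI := integrableOn_normSq_div_cube_compl_ball hU hρ hr hE
  refine Integrable.mono' (hI.const_mul 2) ?_ (ae_restrict_of_forall_mem measurableSet_ball.compl fun y hy => ?_)
  · refine ContinuousOn.aestronglyMeasurable (fun y hy => ?_) measurableSet_ball.compl
    have hy' : ‖y‖ ≠ 0 := by
      intro h0; rw [mem_compl_iff, mem_ball_zero_iff, h0] at hy; exact hy hr
    have hy2 : ‖y‖ ^ 2 ≠ 0 := pow_ne_zero 2 hy'
    have hy3 : ‖y‖ ^ 3 ≠ 0 := pow_ne_zero 3 hy'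
    refine ContinuousAt.continuousWithinAt ?_
    have hUc : ContinuousAt U y := hU.continuousAt
    fun_prop (disch := assumption)
  · have hN0 : 0 ≤ ⟪U y, y⟫ ^ 2 / ‖y‖ ^ 2 := div_nonneg (sq_nonneg _) (sq_nonneg _)
    have hN1 := inner_sq_div_norm_sq_le_ff (U y) y
    have hy0 : 0 < ‖y‖ := by
      have h1 : ¬ ‖y‖ < r := fun h => hy (mem_ball_zero_iff.2 h)
      linarith
    have hy3 : 0 < ‖y‖ ^ 3 := pow_pos hy0 3
    rw [Real.norm_eq_abs, abs_div, abs_of_pos hy3, div_le_iff₀ hy3]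
    have e : 2 * (‖U y‖ ^ 2 / ‖y‖ ^ 3) * ‖y‖ ^ 3 = 2 * ‖U y‖ ^ 2 := by field_simp
    rw [e, show 3 * ⟪U y, y⟫ ^ 2 / ‖y‖ ^ 2 = 3 * (⟪U y, y⟫ ^ 2 / ‖y‖ ^ 2) by ring]
    exact abs_le.2 ⟨by nlinarith, by nlinarith⟩

end Budget


/-! ## Sphere selection on dyadic blocks; Young's inequality for the pressure budget -/

section Selection

variable {U : EuclideanSpace ℝ (Fin 3) → EuclideanSpace ℝ (Fin 3)} {Q : EuclideanSpace ℝ (Fin 3) → ℝ}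

/-- **A cheap sphere in every dyadic block**: for continuous `U`, `Q` and `R > 0` there is `t ∈ [R, 2R]` with
`R·t²·∫_σ(‖U(tθ)‖² + |Q(tθ)|)dσ ≤ ∫_{B_{2R}∖B_R}(‖U‖² + |Q|)` (polar coordinates on the shell + the mean-value selection
`exists_le_setAverage`). [folklore] -/
theorem exists_radius_sphere_le_shell (hU : Continuous U) (hQ : Continuous Q) {R : ℝ} (hR : 0 < R) :
    ∃ t ∈ Icc R (2 * R), R * (t ^ 2 * ∫ θ : sphere (0 : EuclideanSpace ℝ (Fin 3)) 1,
        (‖U (t • (θ : EuclideanSpace ℝ (Fin 3)))‖ ^ 2 + |Q (t • (θ : EuclideanSpace ℝ (Fin 3)))|)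
          ∂(volume : Measure (EuclideanSpace ℝ (Fin 3))).toSphere)
      ≤ ∫ y in ball (0 : EuclideanSpace ℝ (Fin 3)) (2 * R) \ ball 0 R, (‖U y‖ ^ 2 + |Q y|) := by
  have hg : Continuous fun y : EuclideanSpace ℝ (Fin 3) => ‖U y‖ ^ 2 + |Q y| := by fun_prop
  set f : ℝ → ℝ := fun t => t ^ 2 * sphereIntegral volume (fun y : EuclideanSpace ℝ (Fin 3) => ‖U y‖ ^ 2 + |Q y|) t with hf
  have hfc : Continuous f := (continuous_pow 2).mul (continuous_sphereIntegral volume hg)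
  have hR2 : R ≤ 2 * R := by linarith
  -- the shell integral in polar coordinates
  have hI : IntegrableOn (fun y : EuclideanSpace ℝ (Fin 3) => ‖U y‖ ^ 2 + |Q y|) (ball (0 : EuclideanSpace ℝ (Fin 3)) (2 * R) \ ball 0 R) :=
    ((hg.continuousOn.integrableOn_compact (isCompact_closedBall (0 : EuclideanSpace ℝ (Fin 3)) (2 * R))).mono_set
      fun y hy => ball_subset_closedBall hy.1)
  have hpolar := setIntegral_shell_eq_intervalIntegral_sphereIntegral hI hR hR2
  simp only [add_zero] at hpolar
  -- mean-value selection on `[R, 2R]`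
  have hvol : volume (Icc R (2 * R)) = ENNReal.ofReal R := by rw [Real.volume_Icc]; ring_nf
  have hne : volume (Icc R (2 * R)) ≠ 0 := by rw [hvol]; exact (ENNReal.ofReal_pos.2 hR).ne'
  have hfin : volume (Icc R (2 * R)) ≠ ∞ := by rw [hvol]; exact ENNReal.ofReal_ne_top
  obtain ⟨t, ht, hle⟩ := exists_le_setAverage hne hfin (hfc.integrableOn_Icc (a := R) (b := 2 * R))
  refine ⟨t, ht, ?_⟩
  rw [setAverage_eq, measureReal_def, hvol, ENNReal.toReal_ofReal hR.le, smul_eq_mul, integral_Icc_eq_integral_Ioc,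
    ← intervalIntegral.integral_of_le hR2] at hle
  have h2 : R * f t ≤ ∫ x in R..2 * R, f x := by
    calc R * f t ≤ R * (R⁻¹ * ∫ x in R..2 * R, f x) := mul_le_mul_of_nonneg_left hle hR.le
      _ = ∫ x in R..2 * R, f x := by field_simp
  have e : R * f t = R * (t ^ 2 * ∫ θ : sphere (0 : EuclideanSpace ℝ (Fin 3)) 1,
      (‖U (t • (θ : EuclideanSpace ℝ (Fin 3)))‖ ^ 2 + |Q (t • (θ : EuclideanSpace ℝ (Fin 3)))|)
        ∂(volume : Measure (EuclideanSpace ℝ (Fin 3))).toSphere) := by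
    simp only [hf, sphereIntegral_def]
  rw [← e, hpolar]
  exact h2

/-- Young with exponents `3/2` and `3`: `u ≤ (2/3)μ·u^{3/2} + (1/3)μ⁻²` for `u ≥ 0`, `μ > 0`
(`a = μ^{2/3}u`, `b = μ^{−2/3}`). [folklore] -/
theorem le_young_three_halves {u μ : ℝ} (hu : 0 ≤ u) (hμ : 0 < μ) :
    u ≤ 2 / 3 * μ * u ^ (3 / 2 : ℝ) + 1 / 3 * μ⁻¹ ^ 2 := by
  have hpq : (3 / 2 : ℝ).HolderConjugate 3 := by
    rw [Real.holderConjugate_iff]; norm_num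
  have ha : 0 ≤ μ ^ (2 / 3 : ℝ) * u := mul_nonneg (Real.rpow_nonneg hμ.le _) hu
  have hb : 0 ≤ μ ^ (-(2 / 3) : ℝ) := Real.rpow_nonneg hμ.le _
  have h := Real.young_inequality_of_nonneg ha hb hpq
  have e0 : μ ^ (2 / 3 : ℝ) * u * μ ^ (-(2 / 3) : ℝ) = u := by
    rw [mul_comm, ← mul_assoc, ← Real.rpow_add hμ]; norm_num
  have e1 : (μ ^ (2 / 3 : ℝ) * u) ^ (3 / 2 : ℝ) = μ * u ^ (3 / 2 : ℝ) := by
    rw [Real.mul_rpow (Real.rpow_nonneg hμ.le _) hu, ← Real.rpow_mul hμ.le]; norm_num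
  have e2 : (μ ^ (-(2 / 3) : ℝ)) ^ (3 : ℝ) = μ⁻¹ ^ 2 := by
    rw [← Real.rpow_mul hμ.le, show (-(2 / 3) : ℝ) * 3 = -2 by norm_num, Real.rpow_neg hμ.le,
      show (2 : ℝ) = ((2 : ℕ) : ℝ) by norm_num, Real.rpow_natCast, inv_pow]
  rw [e0, e1, e2] at h
  linarith

/-- **The (D)-budget side**: for continuous `Q` with `∫|Q|^{3/2}‖y‖^{2ρ−2} < ∞`, every measurable `S ⊆ {‖y‖ ≥ r}` (`r > 0`) on which
`|Q|` and `‖y‖^{4−4ρ}` are integrable, and every `ε > 0`: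
`∫_S |Q| ≤ (2/3)ε·∫|Q|^{3/2}‖y‖^{2ρ−2} + (1/3)ε⁻²·∫_S ‖y‖^{4−4ρ}` (pointwise Young with `μ = ε‖y‖^{2ρ−2}`). [folklore] -/
theorem setIntegral_abs_le_young {ρ r ε : ℝ} (hr : 0 < r) (hε : 0 < ε)
    (hD : Integrable (fun y : EuclideanSpace ℝ (Fin 3) => |Q y| ^ (3 / 2 : ℝ) * ‖y‖ ^ (2 * ρ - 2)))
    {S : Set (EuclideanSpace ℝ (Fin 3))} (hS : MeasurableSet S) (hSr : S ⊆ (ball (0 : EuclideanSpace ℝ (Fin 3)) r)ᶜ)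
    (hQS : IntegrableOn (fun y => |Q y|) S) (hWS : IntegrableOn (fun y : EuclideanSpace ℝ (Fin 3) => ‖y‖ ^ (4 - 4 * ρ)) S) :
    ∫ y in S, |Q y| ≤ 2 / 3 * ε * (∫ y, |Q y| ^ (3 / 2 : ℝ) * ‖y‖ ^ (2 * ρ - 2))
      + 1 / 3 * ε⁻¹ ^ 2 * ∫ y in S, ‖y‖ ^ (4 - 4 * ρ) := by
  have hpt : ∀ y ∈ S, |Q y| ≤ 2 / 3 * ε * (|Q y| ^ (3 / 2 : ℝ) * ‖y‖ ^ (2 * ρ - 2)) + 1 / 3 * ε⁻¹ ^ 2 * ‖y‖ ^ (4 - 4 * ρ) := by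
    intro y hy
    have hy0 : 0 < ‖y‖ := by
      have h1 : ¬ ‖y‖ < r := fun h => hSr hy (mem_ball_zero_iff.2 h)
      linarith
    have hw : 0 < ‖y‖ ^ (2 * ρ - 2) := Real.rpow_pos_of_pos hy0 _
    have h := le_young_three_halves (abs_nonneg (Q y)) (mul_pos hε hw)
    have e : (ε * ‖y‖ ^ (2 * ρ - 2))⁻¹ ^ 2 = ε⁻¹ ^ 2 * ‖y‖ ^ (4 - 4 * ρ) := by
      rw [mul_inv, mul_pow, ← Real.rpow_neg hy0.le, ← Real.rpow_natCast (‖y‖ ^ (-(2 * ρ - 2))) 2, ← Real.rpow_mul hy0.le]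
      norm_num
      ring_nf
      simp
    rw [e] at h
    linarith
  have hI2 : IntegrableOn (fun y : EuclideanSpace ℝ (Fin 3) =>
      2 / 3 * ε * (|Q y| ^ (3 / 2 : ℝ) * ‖y‖ ^ (2 * ρ - 2)) + 1 / 3 * ε⁻¹ ^ 2 * ‖y‖ ^ (4 - 4 * ρ)) S :=
    (hD.integrableOn.const_mul (2 / 3 * ε)).add (hWS.const_mul (1 / 3 * ε⁻¹ ^ 2))
  have hmono := setIntegral_mono_on hQS hI2 hS hpt
  rw [integral_add (hD.integrableOn.const_mul _) (hWS.const_mul _), integral_const_mul, integral_const_mul] at hmono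
  have hsub : ∫ y in S, |Q y| ^ (3 / 2 : ℝ) * ‖y‖ ^ (2 * ρ - 2) ≤ ∫ y, |Q y| ^ (3 / 2 : ℝ) * ‖y‖ ^ (2 * ρ - 2) :=
    setIntegral_le_integral hD (ae_of_all _ fun y => mul_nonneg (Real.rpow_nonneg (abs_nonneg _) _) (Real.rpow_nonneg (norm_nonneg _) _))
  nlinarith [hsub, hε.le]

end Selection

end ClassicalProfile

end Summit.NavierStokesRegularity.NavierStokesRegularity.Theorems.PowerGaugeEulerLiouville

end
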